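import Summits.Ventures.Crystal3D.Kissing125.GSearchRelabel2
import HarnessLib

/-!
# Sides, growth and relabelling in the growth search, κ-generic — part 3/3

HONEST FRAMING (cell pub-crystal3d, K-path at `h = 5/4`, V4 = κ as an explicit parameter): this is NOT a result printed
by Hales; it is his METHOD (arXiv:1209.6043, Theorem 3 + Lemmas 7–10, in the tree's form of a verified interval-arithmetic
growth search, `Literature/…/KissingSearch*.lean`) with the largest long-side cosine `κ` made an EXPLICIT PARAMETER
(`κ : Kappa`, carrying the two numeric facts the soundness proof uses: `-1/2 ≤ κ`, `κ < 1/4`).  Only the declarations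
whose statement depends on `κ` are declared here (namespace `…Kissing125.GSearch`, the tree's short names, no renames);
every κ-free helper is the landed K25 copy (`…Kissing125.KissingSearch.*`) and every κ-free lemma is cited from the tree
(PRIVATE per-file citation aliases; `GSearchTransport.lean` holds `toT : St → tree St` and the transport equalities).  The K25
instance is `κ25 = ⟨7/32, …⟩`; `GSearchBridge.lean` identifies the generic checker at
`κ25` with the landed `Kissing125.KissingSearch.checkPart`, so the landed run files are consumed unchanged.  Generated by
`HOME/lean/kissing125/v4-prep/gen/mkgen.py`; nothing here is asserted about GAP(1.26) or any census.

THIS FILE: the κ-tainted declarations of `Literature/Geometry/DiscreteGeometry/KissingSearchRelabel.lean` (part 3 of 3), with `κ : Kappa` threaded; κ-free declarations of that file are NOT re-declared publicly (the κ-free helpers are the landed K25 copies; the κ-free tree lemmas used by the proofs are cited through PRIVATE aliases at the top of the file).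

## References
* T. C. Hales, *A proof of Fejes Tóth's conjecture on sphere packings with kissing number twelve*,
  arXiv:1209.6043 (2012): Definition 1, Theorem 2, Theorem 3, Lemmas 7–10. [`Hales2012`]
* R. E. Moore, *Interval Analysis* (1966), Theorem 3.1, §4.4. [`Moore1966`]
-/

namespace Summit.Ventures.Crystal3D.Kissing125

open Literature.Geometry.DiscreteGeometry
open Summit.Ventures.Crystal3D.Kissing125.KissingSearch

namespace GSearch

open Real Literature.Analysis.ValidatedNumerics KissingLP NonemptyInterval Finset

variable {κ : Kappa}

/-! ### κ-free tree lemmas used below, read over the K25 copies (PRIVATE citation aliases; the public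
surface of this file is κ-generic only) -/

/-- K25 reading of the tree lemma `gdom_sdom_of_ne` (κ-free; proof = citation of the tree lemma). [folklore] -/
private theorem gdom_sdom_of_ne {s : St} {a b r p q : ℕ}
  (hne : sIdx p q ≠ sIdx a b) : (s.sdom a b r).gdom p q = s.gdom p q :=
  Literature.Geometry.DiscreteGeometry.KissingSearch.gdom_sdom_of_ne (s := toT s) hne

/-- K25 reading of the tree lemma `gdom_sdom_self` (κ-free; proof = citation of the tree lemma). [folklore] -/
private theorem gdom_sdom_self {s : St} {a b r : ℕ} (h : sIdx a b < s.dom.size) :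
  (s.sdom a b r).gdom a b = r :=
  Literature.Geometry.DiscreteGeometry.KissingSearch.gdom_sdom_self (s := toT s) h

/-- K25 reading of the tree lemma `gsc_addTri_aux` (κ-free; proof = citation of the tree lemma). [folklore] -/
private theorem gsc_addTri_aux {sc : Array ℕ} (hsz : sc.size = 144) (a b c : ℕ)
  {p q : ℕ} (hp : p < 12) (hq : q < 12) :
  (((sc.modify (sIdx a b) fun x ↦ x + 1).modify (sIdx a c) fun x ↦ x + 1).modify (sIdx b c) fun x ↦ x + 1).getD
      (sIdx p q) 0 =
    ((sc.getD (sIdx p q) 0 + if sIdx p q = sIdx a b then 1 else 0) + if sIdx p q = sIdx a c then 1 else 0) +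
      if sIdx p q = sIdx b c then 1 else 0 :=
  Literature.Geometry.DiscreteGeometry.KissingSearch.gsc_addTri_aux hsz a b c hp hq

/-- K25 reading of the tree lemma `gsc_sdom` (κ-free; proof = citation of the tree lemma). [folklore] -/
@[simp] private theorem gsc_sdom {s : St} (a b r p q : ℕ) :
  (s.sdom a b r).gsc p q = s.gsc p q :=
  Literature.Geometry.DiscreteGeometry.KissingSearch.gsc_sdom (s := toT s) a b r p q

/-- K25 reading of the tree lemma `length_filter_append_single` (κ-free; proof = citation of the tree lemma). [folklore] -/
private theorem length_filter_append_single {L : List ℕ} {p : ℕ → Bool} {t : ℕ} :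
  (List.filter p (L ++ [t])).length = (List.filter p L).length + if p t = true then 1 else 0 :=
  Literature.Geometry.DiscreteGeometry.KissingSearch.length_filter_append_single

/-- K25 reading of the tree lemma `sIdx_eq_iff` (κ-free; proof = citation of the tree lemma). [folklore] -/
private theorem sIdx_eq_iff {a b a' b' : ℕ} (ha : a < 12) (hb : b < 12)
  (ha' : a' < 12) (hb' : b' < 12) : sIdx a b = sIdx a' b' ↔ a = a' ∧ b = b' ∨ a = b' ∧ b = a' :=
  Literature.Geometry.DiscreteGeometry.KissingSearch.sIdx_eq_iff ha hb ha' hb'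

/-- K25 reading of the tree lemma `sIdx_lt` (κ-free; proof = citation of the tree lemma). [folklore] -/
private theorem sIdx_lt {a b : ℕ} (ha : a < 12) (hb : b < 12) : sIdx a b < 144 :=
  Literature.Geometry.DiscreteGeometry.KissingSearch.sIdx_lt ha hb

/-- K25 reading of the tree lemma `size_dom_sdom` (κ-free; proof = citation of the tree lemma). [folklore] -/
@[simp] private theorem size_dom_sdom {s : St} (a b r : ℕ) :
  (s.sdom a b r).dom.size = s.dom.size :=
  Literature.Geometry.DiscreteGeometry.KissingSearch.size_dom_sdom (s := toT s) a b r

/-- K25 reading of the tree lemma `sortTri_valid` (κ-free; proof = citation of the tree lemma). [folklore] -/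
private theorem sortTri_valid {a b c : ℕ} (ha : a < 12) (hb : b < 12) (hc : c < 12)
  (hab : a ≠ b) (hac : a ≠ c) (hbc : b ≠ c) : TriValid (sortTri a b c) ∧ tset (sortTri a b c) = {a, b, c} :=
  Literature.Geometry.DiscreteGeometry.KissingSearch.sortTri_valid ha hb hc hab hac hbc

/-- K25 reading of the tree lemma `tmem_iff` (κ-free; proof = citation of the tree lemma). [folklore] -/
private theorem tmem_iff {t v : ℕ} : tmem t v = true ↔ v ∈ tset t :=
  Literature.Geometry.DiscreteGeometry.KissingSearch.tmem_iff

/-- K25 reading of the tree lemma `tris_sdom` (κ-free; proof = citation of the tree lemma). [folklore] -/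
@[simp] private theorem tris_sdom {s : St} (a b r : ℕ) : (s.sdom a b r).tris = s.tris :=
  Literature.Geometry.DiscreteGeometry.KissingSearch.tris_sdom (s := toT s) a b r

/-- K25 reading of the tree lemma `sc_sdom` (κ-free; proof = citation of the tree lemma). [folklore] -/
@[simp] private theorem sc_sdom {s : St} (a b r : ℕ) : (s.sdom a b r).sc = s.sc :=
  Literature.Geometry.DiscreteGeometry.KissingSearch.sc_sdom (s := toT s) a b r


section Grow
variable {M : KConf κ} {s : St}
/-- **The growth step keeps the state realized.**  In a realized state, let `{v, a, c}` be a
triangle of `M` that is not placed, with `v, a, c` distinct labels `< 12`; then `addTri v a c`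
succeeds and, after writing the true codes on `{v, c}` and `{a, c}`, the state is realized —
provided the side `{v, a}` is already labelled. [folklore] -/
theorem realizes_grow {M : KConf κ} {s : St} (hR : Realizes M s) {v a c : ℕ} (hv : v < 12) (ha : a < 12) (hc : c < 12)
    (hva : v ≠ a) (hvc : v ≠ c) (hac : a ≠ c) (hT : ({v, a, c} : Finset ℕ) ∈ M.T)
    (hun : ∀ t ∈ s.tris.toList, tset t ≠ {v, a, c}) (hlab : s.gdom v a ≠ UNL) :
    ∃ s', s.addTri v a c = some s' ∧
      Realizes M ((s'.sdom v c (trueCode M s v c)).sdom a c (trueCode M s a c)) ∧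
      s'.tris.toList = s.tris.toList ++ [sortTri v a c] ∧ s'.dom = s.dom ∧
      (∀ p q, p < 12 → q < 12 → s'.gsc p q = s.gsc p q +
        (if sIdx p q = sIdx v a then 1 else 0) + (if sIdx p q = sIdx v c then 1 else 0) + (if sIdx p q = sIdx a c then 1 else 0)) := by
  classical
  obtain ⟨hval, hset⟩ := sortTri_valid hv ha hc hva hvc hac
  set t₁ := sortTri v a c with ht₁
  have hnot : t₁ ∉ s.tris.toList := fun h => hun t₁ h hset
  -- the new side-count array and its reading
  have hgsc : ∀ p q, p < 12 → q < 12 →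
      (⟨s.tris.push t₁, s.dom, ((s.sc.modify (sIdx v a) (· + 1)).modify (sIdx v c) (· + 1)).modify (sIdx a c) (· + 1)⟩ : St).gsc p q =
        s.gsc p q + (if sIdx p q = sIdx v a then 1 else 0) + (if sIdx p q = sIdx v c then 1 else 0) +
          (if sIdx p q = sIdx a c then 1 else 0) := by
    intro p q hp hq
    unfold St.gsc
    exact gsc_addTri_aux hR.size_sc v a c hp hq
  -- counts stay `≤ 2` on the three sides
  have hT2 : ∀ {p q : ℕ}, p < 12 → q < 12 → p ≠ q → p ∈ ({v, a, c} : Finset ℕ) → q ∈ ({v, a, c} : Finset ℕ) →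
      s.gsc p q ≤ 1 := by
    intro p q hp hq hpq hpm hqm
    -- the placed triangles on `{p, q}` inject into `M.onSide p q \\ {{v,a,c}}`
    rw [gsc_eq_length hR hp hq hpq]
    obtain ⟨hsub, hcard⟩ := card_image_onSideL hR p q
    have h2 : (M.onSide p q).card = 2 := M.two _ hT p hpm q hqm hpq
    have hnotin : ({v, a, c} : Finset ℕ) ∉ ((s.onSideL p q).map tset).toFinset := by
      rw [List.mem_toFinset, List.mem_map]
      rintro ⟨t, ht, e⟩
      unfold St.onSideL at ht
      exact hun t (List.mem_filter.1 ht).1 e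
    have hmem : ({v, a, c} : Finset ℕ) ∈ M.onSide p q := by
      unfold KConf.onSide; rw [Finset.mem_filter]; exact ⟨hT, hpm, hqm⟩
    have hss : ((s.onSideL p q).map tset).toFinset ⊂ M.onSide p q :=
      Finset.ssubset_iff_subset_ne.2 ⟨hsub, fun e => hnotin (e ▸ hmem)⟩
    have := Finset.card_lt_card hss
    rw [hcard, h2] at this
    omega
  have hmemv : v ∈ ({v, a, c} : Finset ℕ) := by simp
  have hmema : a ∈ ({v, a, c} : Finset ℕ) := by simp
  have hmemc : c ∈ ({v, a, c} : Finset ℕ) := by simp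
  have cva := hT2 hv ha hva hmemv hmema
  have cvc := hT2 hv hc hvc hmemv hmemc
  have cac := hT2 ha hc hac hmema hmemc
  -- `addTri` succeeds
  have hadd : s.addTri v a c =
      some ⟨s.tris.push t₁, s.dom, ((s.sc.modify (sIdx v a) (· + 1)).modify (sIdx v c) (· + 1)).modify (sIdx a c) (· + 1)⟩ := by
    unfold St.addTri
    rw [← ht₁]
    have hc1 : ¬ s.tris.contains t₁ = true := by
      rw [Array.contains_iff_mem, Array.mem_def]; exact hnot
    simp only [hc1, Bool.false_eq_true, ↓reduceIte]
    have e1 := hgsc v a hv ha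
    have e2 := hgsc v c hv hc
    have e3 := hgsc a c ha hc
    have n1 : sIdx v a ≠ sIdx v c := by rw [Ne, sIdx_eq_iff hv ha hv hc]; omega
    have n2 : sIdx v a ≠ sIdx a c := by rw [Ne, sIdx_eq_iff hv ha ha hc]; omega
    have n3 : sIdx v c ≠ sIdx a c := by rw [Ne, sIdx_eq_iff hv hc ha hc]; omega
    rw [if_neg]
    rw [e1, e2, e3]
    simp only [n1, n2, n3, Ne.symm n1, Ne.symm n2, Ne.symm n3, ↓reduceIte]
    omega
  refine ⟨_, hadd, ?_, by simp, rfl, hgsc⟩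
  -- the realized state after the two writes
  set s' : St := ⟨s.tris.push t₁, s.dom, ((s.sc.modify (sIdx v a) (· + 1)).modify (sIdx v c) (· + 1)).modify (sIdx a c) (· + 1)⟩
    with hs'
  have htris' : s'.tris.toList = s.tris.toList ++ [t₁] := by simp [hs']
  obtain ⟨semvc, nUvc⟩ := domSem_trueCode hR hv hc hvc hT hmemv hmemc
  obtain ⟨semac, nUac⟩ := domSem_trueCode hR ha hc hac hT hmema hmemc
  set r1 := trueCode M s v c
  set r2 := trueCode M s a c
  have n3 : sIdx v c ≠ sIdx a c := by rw [Ne, sIdx_eq_iff hv hc ha hc]; omega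
  -- reading the final domains
  have gd : ∀ p q, ((s'.sdom v c r1).sdom a c r2).gdom p q =
      if sIdx p q = sIdx a c then r2 else if sIdx p q = sIdx v c then r1 else s.gdom p q := by
    intro p q
    by_cases h1 : sIdx p q = sIdx a c
    · rw [if_pos h1]; unfold St.gdom; rw [h1]
      exact gdom_sdom_self (by rw [size_dom_sdom]; show sIdx a c < s.dom.size; rw [hR.size_dom]; exact sIdx_lt ha hc)
    · rw [if_neg h1, gdom_sdom_of_ne h1]
      by_cases h2 : sIdx p q = sIdx v c
      · rw [if_pos h2]; unfold St.gdom; rw [h2]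
        exact gdom_sdom_self (by show sIdx v c < s.dom.size; rw [hR.size_dom]; exact sIdx_lt hv hc)
      · rw [if_neg h2, gdom_sdom_of_ne h2]; rfl
  exact {
    size_dom := by rw [size_dom_sdom, size_dom_sdom]; exact hR.size_dom
    size_sc := by simp [hs', hR.size_sc]
    valid := by
      intro t ht
      simp only [tris_sdom, htris', List.mem_append, List.mem_singleton] at ht
      rcases ht with ht | rfl
      · exact hR.valid t ht
      · exact hval
    mem := by
      intro t ht
      simp only [tris_sdom, htris', List.mem_append, List.mem_singleton] at ht
      rcases ht with ht | rfl
      · exact hR.mem t ht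
      · rw [hset]; exact hT
    nodup := by
      simp only [tris_sdom, htris']
      exact List.nodup_append.2 ⟨hR.nodup, List.nodup_singleton _, fun t ht t' ht' => by
        rw [List.mem_singleton] at ht'; rw [ht']; exact fun e => hnot (e ▸ ht)⟩
    sc_eq := by
      intro p q hp hq hpq
      rw [gsc_sdom, gsc_sdom, hgsc p q hp hq, hR.sc_eq p q hp hq hpq]
      simp only [tris_sdom, htris']
      rw [length_filter_append_single]
      -- `p, q ∈ t₁` iff `{p, q}` is one of the three sides
      have hm : ((tmem t₁ p && tmem t₁ q) = true) = (p ∈ ({v, a, c} : Finset ℕ) ∧ q ∈ ({v, a, c} : Finset ℕ)) := by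
        rw [Bool.and_eq_true, tmem_iff, tmem_iff, hset]
      simp only [hm, Finset.mem_insert, Finset.mem_singleton, sIdx_eq_iff hp hq hv ha, sIdx_eq_iff hp hq hv hc,
        sIdx_eq_iff hp hq ha hc]
      split_ifs <;> omega
    dom := by
      intro p q hp hq hpq
      rw [gd]
      split_ifs with h1 h2
      · rcases (sIdx_eq_iff hp hq ha hc).1 h1 with ⟨rfl, rfl⟩ | ⟨rfl, rfl⟩
        · exact semac
        · rw [M.g_symm]; exact semac
      · rcases (sIdx_eq_iff hp hq hv hc).1 h2 with ⟨rfl, rfl⟩ | ⟨rfl, rfl⟩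
        · exact semvc
        · rw [M.g_symm]; exact semvc
      · exact hR.dom p q hp hq hpq
    lab_side := by
      intro p q hp hq hpq hl
      simp only [tris_sdom, htris']
      rw [gd] at hl
      have ht₁m : t₁ ∈ s.tris.toList ++ [t₁] := by simp
      split_ifs at hl with h1 h2
      · rcases (sIdx_eq_iff hp hq ha hc).1 h1 with ⟨rfl, rfl⟩ | ⟨rfl, rfl⟩
        · exact ⟨t₁, ht₁m, by rw [hset]; simp, by rw [hset]; simp⟩
        · exact ⟨t₁, ht₁m, by rw [hset]; simp, by rw [hset]; simp⟩
      · rcases (sIdx_eq_iff hp hq hv hc).1 h2 with ⟨rfl, rfl⟩ | ⟨rfl, rfl⟩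
        · exact ⟨t₁, ht₁m, by rw [hset]; simp, by rw [hset]; simp⟩
        · exact ⟨t₁, ht₁m, by rw [hset]; simp, by rw [hset]; simp⟩
      · obtain ⟨t, ht, h1', h2'⟩ := hR.lab_side p q hp hq hpq hl
        exact ⟨t, List.mem_append_left _ ht, h1', h2'⟩
    side_lab := by
      intro t ht p hp q hq hpq
      rw [gd]
      split_ifs with h1 h2
      · exact nUac
      · exact nUvc
      · simp only [tris_sdom, htris', List.mem_append, List.mem_singleton] at ht
        rcases ht with ht | rfl
        · exact hR.side_lab t ht p hp q hq hpq
        · -- a side of the new triangle other than `{v,c}`, `{a,c}`: it is `{v, a}`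
          rw [hset] at hp hq
          simp only [Finset.mem_insert, Finset.mem_singleton] at hp hq
          have hp12 : p < 12 := by rcases hp with rfl | rfl | rfl <;> assumption
          have hq12 : q < 12 := by rcases hq with rfl | rfl | rfl <;> assumption
          have hva' : sIdx p q = sIdx v a := by
            rw [sIdx_eq_iff hp12 hq12 hv ha]
            rw [sIdx_eq_iff hp12 hq12 hv hc] at h2
            rw [sIdx_eq_iff hp12 hq12 ha hc] at h1
            omega
          rw [show s.gdom p q = s.gdom v a by unfold St.gdom; rw [hva']]
          exact hlab }

end Grow


end GSearch

end Summit.Ventures.Crystal3D.Kissing125
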